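import Literature.MathematicalPhysics.QuantumFieldTheory.Balaban1983to89.B2Eq246MaskedStep

/-!
# `Balaban1983to89.B2Eq245Assembled` — T. Bałaban, *(Higgs)₂,₃ quantum fields in a finite volume. II. An upper bound*,
Commun. Math. Phys. **86** (1982) 555–594 [Balaban1982Higgs2] p. 567 [PDF 13]: the displays **(2.45)** and **(2.46)** — the
density `ρ″^{(k),L^kε}(Λ₀^{(0)}, …, Λ₀^{(k−1)}, A, θ_kA^{(k),ε}, φ)` before and after *"calculation of a conditional integral in (2.45)
with the conditioning on Λ₅^{(k−1)c}"* — AS DISPLAYED on the concrete (Higgs)₂,₃ carrier (both field species; print's masks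
`Λ₆^{(k−2)′}` for `A′` and `Λ₃^{(k−1)}` for `φ′`; the two middle `φ′`-terms with `Δ^{(k−1)}(B^{k−1}(Λ₂^{(k−2)′}∩Λ₅^{(k−1)c}), Ã′)`
verbatim; the kernel's field `Ã` and the form's field `A^{(k),ε}`; `χ_k`, `ζ_{Λ₀^{(k−1)}}`, `χ_{Λ₋₁^{(k−1)}∩Λ₅^{(k−1)c}}`, `χ_{k−1,Λ₅^{(k−1)c}}`,
`ρ′^{(k−1)}` as NAMED data), and **(2.45) = (2.46) PROVED** (`display245_eq_display246`) from the masked conditional step of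
`B2Eq246MaskedStep` applied twice (first `dφ′`, then `dA′`)

statement-level skeleton of published theorems with citation tags; proofs where landed; nothing here is a claim about the Yang–Mills mass gap

PDFs held: `paper:balaban1982-cmp86-higgs23-ii` (journal page = PDF page + 554), pp. 566–569 [PDF 12–15] read AS IMAGES on the ×2
renders `run/shared/lean/pub/pub-balaban/b2b-balaban-ref1/pages/1982-cmp86-higgs23-II/1982-cmp86-higgs23-II-p012-x2.png` … `-p015-x2.png`
(the OCR layer garbles both displays); part I [Balaban1982Higgs1] pp. 605, 608, 611.

CITATION HEADER (lean-in-tree rule).  lit-balaban typed skeleton (HOME `run/shared/lean/pub/lit-balaban/`), reader/typer and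
fold-owner line r02 (unit `lit-balaban-r02`, gen 52); SKELETON row **B2.Eq2.44** ((2.44)–(2.52), pp. 566–569, owner r02, second
reader r14).  Members of record before this file: (2.44) `B2StepK.bg244`/`IsCutoff244` (r14) with the cut-off CONSTRUCTED
`B2Eq244Cutoff` (p23 p315440/p317138) and `θ_k` CONSTRUCTED `B2Eq245Theta.thetaOf` (p321142); (2.45)-`Ã` `B2Sect2BDensities.aTilde245`,
(2.47)–(2.52) `B2Sect2BDensities` (r14 p248067/p249635); the conditional step (2.45)→(2.46) for the concrete objects with the basic
form on all of `T^{(j)}`: `B2Eq246ScalarStep.rt_condStep`, `B2Eq246PairStep.rt_condStep_pair` (typer g5, p256625/p257530), the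
conditional covariance `HiggsCondCov232.condCov232`, the new form `B2Eq227CondDelta.condDelta227`, (2.52) `zCond252`.  The owner's
READING-RULE AUDIT (`HOME/lit-balaban-r02/READING-RULE-AUDIT-B2-g50.md` §6) found the reading rule (a) failing for (2.45)/(2.46)
only (*"the displays themselves (ρ^{(k)} over the region system at the translated fields with the (2.52)-factors) are not
assembled"*) and named the owed member `B2Eq245Assembled` — THIS FILE; its prerequisite, the step WITH print's masks and kernel
field, is `B2Eq246MaskedStep` (r02 g52).  NOTHING of record is restated: kernels `HiggsAveraging.rtKernelStep` / the typer's
`rtKernelOut`, forms `B1Eq230FluctCov.deltaKA` (I (2.21)), `condCov232` (I (2.32)), `condDelta227` (II (2.27)), `avgQAdjLin`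
(I (2.7) adjoint), `zCond252` ((2.52)), cuts `B2Eq255Concrete.cutTo`, exterior coordinates `fieldOfOut`, the step
`B2Eq246MaskedStep.rt_condStep_masked` — all BY NAME.

THE SOURCE TEXT, p. 567 [PDF 13], verbatim:
*"The density ρ^{(k),L^kε} is defined inductively by the formulas generalizing (2.34)–(2.42). At first we define
ρ″^{(k),L^kε}(Λ₀^{(0)}, …, Λ₀^{(k−1)}, A, θ_kA^{(k),ε}, φ)
= χ_k T^{L^{k−1}ε}_{a,L}[T^{L^{k−1}ε}_{a,L,Ã′}[ζ_{Λ₀^{(k−1)}}χ_{Λ₋₁^{(k−1)}∩Λ₅^{(k−1)c}}χ_{k−1,Λ₅^{(k−1)c}} · ρ′^{(k−1),L^{k−1}ε}(Λ₀^{(0)}, …, Λ₀^{(k−2)}, A′, Ã′, φ′)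
· exp[−½⟨Λ₆^{(k−2)′}A′, Δ^{(k−1),L^{k−1}ε}Λ₆^{(k−2)′}A′⟩
− ½⟨(Λ₆^{(k−2)′}∩Λ₃^{(k−1)c})φ′, Δ^{(k−1),L^{k−1}ε}(B^{k−1}(Λ₂^{(k−2)′}∩Λ₅^{(k−1)c}), Ã′)(Λ₆^{(k−2)′}∩Λ₃^{(k−1)c})φ′⟩ − ⟨(Λ₆^{(k−2)′}∩Λ₃^{(k−1)c})φ′,
Δ^{(k−1),L^{k−1}ε}(B^{k−1}(Λ₂^{(k−2)′}∩Λ₅^{(k−1)c}), Ã′)(Λ₃^{(k−1)}∩Λ₄^{(k−1)c})φ′⟩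
− ½⟨Λ₃^{(k−1)}φ′, Δ^{(k−1),L^{k−1}ε}(B^{k−1}(Λ₂^{(k−1)}), A^{(k),ε})Λ₃^{(k−1)}φ′⟩]]], (2.45)
where Ã = (1 − θ_k)θ_{k−1}A^{(k−1),ε} + θ_kA^{(k),ε}, and the characteristic functions χ_k, ζ_{Λ₀^{(k−1)}}, etc. are defined analogously
to the corresponding functions in Sect. A, with ε replaced by L^{k−1}ε and Λ₀ by Λ₀^{(k−1)}. Another representation is obtained by
calculation of a conditional integral in (2.45) with the conditioning on Λ₅^{(k−1)c}:
ρ″^{(k),L^kε}(Λ₀^{(0)}, …, Λ₀^{(k−1)}, A, θ_kA^{(k),ε}, φ)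
= χ_k ∫dA′↾_{Λ₅^{(k−1)c}} ∫dφ′↾_{Λ₅^{(k−1)c}} t^{L^{k−1}ε}_{a,L}(Λ₅^{(k−1)c}; A, A′) t^{L^{k−1}ε}_{a,L,Ã}(Λ₅^{(k−1)c}; φ, φ′)
· ζ_{Λ₀^{(k−1)}}χ_{Λ₋₁^{(k−1)}∩Λ₅^{(k−1)c}}χ_{k−1,Λ₅^{(k−1)c}} ρ′^{(k−1),L^{k−1}ε}(Λ₀^{(0)}, …, Λ₀^{(k−2)}, A′, Ã′, φ′)
· exp[−½⟨(Λ₆^{(k−2)′}∩Λ₅^{(k−1)c})A′, Δ^{(k−1),L^{k−1}ε}(Λ₆^{(k−2)′}∩Λ₅^{(k−1)c})A′⟩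
+ ½⟨(Λ₆^{(k−2)′}∩Λ₅^{(k−1)c})A′, Δ^{(k−1),L^{k−1}ε}C^{(k−1),L^{k−1}ε}_{Λ₅^{(k−1)}}Δ^{(k−1),L^{k−1}ε}(Λ₆^{(k−2)′}∩Λ₅^{(k−1)c})A′⟩
− a(L^kε)^{−2}⟨(Λ₆^{(k−2)′}∩Λ₅^{(k−1)c})A′, Δ^{(k−1),L^{k−1}ε}C^{(k−1),L^{k−1}ε}_{Λ₅^{(k−1)}}Q^*A⟩ − ½⟨A, Δ^{(k),L^kε}_{Λ₅^{(k−1)}}A⟩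
− ½⟨(Λ₆^{(k−2)′}∩Λ₃^{(k−1)c})φ′, Δ^{(k−1),L^{k−1}ε}(B^{k−1}(Λ₂^{(k−2)′}∩Λ₅^{(k−1)c}), Ã′)(Λ₆^{(k−2)′}∩Λ₃^{(k−1)c})φ′⟩
− ⟨(Λ₆^{(k−2)′}∩Λ₃^{(k−1)c})φ′, Δ^{(k−1),L^{k−1}ε}(B^{k−1}(Λ₂^{(k−2)′}∩Λ₅^{(k−1)c}), Ã′)(Λ₃^{(k−1)}∩Λ₄^{(k−1)c})φ′⟩
− ½⟨(Λ₃^{(k−1)}∩Λ₅^{(k−1)c})φ′, Δ^{(k−1),L^{k−1}ε}(B^{k−1}(Λ₂^{(k−1)}), A^{(k),ε})(Λ₃^{(k−1)}∩Λ₅^{(k−1)c})φ′⟩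
+ ½⟨(Λ₃^{(k−1)}∩Λ₅^{(k−1)c})φ′, Δ^{(k−1),L^{k−1}ε}(B^{k−1}(Λ₂^{(k−1)}), A^{(k),ε}) C^{(k−1),L^{k−1}ε}_{Λ₅^{(k−1)}}(B^{k−1}(Λ₂^{(k−1)}), A^{(k),ε})
Δ^{(k−1),L^{k−1}ε}(B^{k−1}(Λ₂^{(k−1)}), A^{(k),ε})(Λ₃^{(k−1)}∩Λ₅^{(k−1)c})φ′⟩
− a(L^kε)^{−2}⟨(Λ₃^{(k−1)}∩Λ₅^{(k−1)c})φ′, Δ^{(k−1),L^{k−1}ε}(B^{k−1}(Λ₂^{(k−1)}), A^{(k),ε}) C^{(k−1),L^{k−1}ε}_{Λ₅^{(k−1)}}(B^{k−1}(Λ₂^{(k−1)}), A^{(k),ε})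
Q^*(A^{(k),ε})φ⟩ − ½⟨φ, Δ^{(k),L^kε}_{Λ₅^{(k−1)}}(B^{k−1}(Λ₂^{(k−1)}), A^{(k),ε})φ⟩]
· Z^{(k−1),L^{k−1}ε}_{Λ₅^{(k−1)}} Z^{(k−1),L^{k−1}ε}_{Λ₅^{(k−1)}}(B^{k−1}(Λ₂^{(k−1)}), A^{(k),ε}). (2.46)"*;
p. 566: *"We will use the same notations for the sets in different scales"*; p. 568: *"and similarly for the form ⟨A, Δ^{(k),L^kε}_{Λ₅^{(k−1)}}A⟩,
except that Neumann boundary conditions are not introduced"*; p. 569: *"Obviously we have B^{k−2}(Λ₂^{(k−2)})Ã^ε = Ã′ [we write here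
A_{k−1} = A′, φ_{k−1} = φ′ in (2.45), (2.46)]"*; I p. 605: the Lebesgue measures on the configuration spaces; I p. 608 (2.4)–(2.7).

HOW IT IS TYPED (the typer's letters of `B2Eq246ScalarStep`/`B2Eq246PairStep`: step `k − 1 ↦ j`).  The fields: new `A` ↦ `An :
ScalarField P (j+1) d` (vector fields as `ℝ^d`-valued site functions, p. 555 *"Vector field configurations are the functions A :
T_ε → R^d"*), new `φ` ↦ `φ : ScalarField P (j+1) N`, fluctuation `A′`, `φ′` ↦ site functions of level `j`; the external fields
`A^{(k),ε}`, `Ã`, `Ã′` on `T_ε`; the regions as finite sets of sites at the scale where the display uses them (`Data245`); the two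
renormalization transformations `T_{a,L}[T_{a,L,Ã}[·]]` (I (2.4)–(2.6)) as their kernel integrals with `HiggsAveraging.rtKernelStep`
(vector species = the letters `N = d`, `zeroCharge`, field `0`); `∫dA′↾_{Λ₅ᶜ}∫dφ′↾_{Λ₅ᶜ}` = Lebesgue integrals over the exterior
coordinates `Out (inSet · (B(Λ′₅)))` with exterior fields `fieldOfOut`; `t(Λ₅ᶜ;·,·)` = `rtKernelOut`; the ten exponential lines
as `siteInner` expressions against `deltaKA`/`condCov232`/`avgQAdjLin`/`condDelta227` exactly as printed (`vecForm245`, `midForm245`,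
`scalForm245`; `vecTerms246`, `midForm245`, `scalTerms246`), `a(L^kε)^{−2}` ↦ `stepCoef P a j`; `Z·Z` ↦ `zCond252`·`zCond252`.  What print
constructs elsewhere is DATA here (`Data245`: regions, fields, the four characteristic functions, `ρ′^{(k−1)}`), and what print's
construction supplies about the data is the hypothesis structure `Data245.Hyp` (nesting of the regions; `Ã = A^{(k),ε}` on the bonds
inside `B^{k−1}(Λ′₅)` — *"θ_k … is equal to 1 on B^{k−1}(Λ₂^{(k−1)})"*; locality of the weights in `Λ₅^{(k−1)c}` — the conditioning and
(2.50); nonnegativity; measurability).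

WHAT IS PROVED (kernel-checked, 0 `sorry`, standard axioms; definitions WITH BODY + theorems; NO `Prop`-valued fact except the
hypothesis bundle `Data245.Hyp`, a `structure … : Prop` consumed as a hypothesis, never asserted).
 §1 `Data245`, `weight245` (ζχχρ′), `vecForm245`/`midForm245`/`scalForm245` (lines 1–4 of (2.45)), **`display245`**; `vecTerms246`/
    `scalTerms246` (lines 1–4 / 7–10 of (2.46)), **`display246`**.
 §2 `Data245.Hyp`; `weight245_loc(_left/_right)`, `weight245_nonneg`, `measurable_weight245`; cuts `cutTo_cutTo_eq_inter`,
    `cutTo_cutTo_of_subset`, **`midForm245_cutTo`** (lines 5–6 live outside `Λ₄ ⊃ Λ₅`: unchanged by the conditioning); DICTIONARY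
    **`scalTerms246_eq`**, **`vecTerms246_eq`** (lines 7–10 / 1–4 ARE the typer's `condTerms246` at the masked exterior fields);
    continuity `continuous_rtKernelOut`, `continuous_condTerms246`, `continuous_midForm245`.
 §3 **`inner_step`**: the `dφ′`-integration of (2.45) conditioned on `Λ₅ᶜ` (scalar letters `(C, B^{k−1}(Λ₂^{(k−1)}), A^{(k),ε})`, mask
    `Λ₃^{(k−1)}`, kernel field `Ã`, weight `ζχχρ′·e^{lines 5–6}`).
 §4 `measurable_innerIntegrand`, **`outer_step`** (the `dA′`-integration, vector letters, mask `Λ₆^{(k−2)′}`, weight = the inner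
    result, measurable by `StronglyMeasurable.integral_prod_right'`, nonnegative), and **`display245_eq_display246`**.
HONEST SCOPE.  (a) Regions, external fields, characteristic functions and `ρ′^{(k−1)}` are DATA with the hypotheses `Data245.Hyp`
(print constructs them: (2.7)–(2.8)′, (2.44), (2.4)–(2.6)′/(2.15)′, (2.49)–(2.50); the tree has the constructions
`B2Eq28RegionsConcrete`/`B2Eq243RegionsTower`, `B2Eq244Cutoff`, `B2Eq245Theta`, `B2Eq22LargeFieldSets`, `B2Eq29DictionaryConcrete`;
instantiating `Data245` with them and discharging `Hyp` — in particular `hAk` from `θ_k = 1` on `B^{k−1}(Λ₂^{(k−1)})` ⊇ `B^{k−1}(Λ₅^{(k−1)})`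
— is bookkeeping left to the consumer); (b) print writes the kernel's field `Ã′` in (2.45) and `Ã` in (2.46) (with `Ã′ =
B^{k−2}(Λ₂^{(k−2)})Ã`, p. 569); one datum `Atil` serves both kernels (the identity (2.45) = (2.46) requires the same kernel on both
sides; outside `B^{k−2}(Λ₂^{(k−2)})` all fields of the step vanish anyway by the characteristic functions — not formalised);
(c) vector fields as `ℝ^d`-valued site functions (the typer's convention; the bond-function form of `B2Eq253StepIntegral` is related
by `HiggsDoubleRT.measurePreserving_toSite`, not restated here); (d) no convergence statement: the weights are nonnegative, so
when the integrand of (2.45) is integrable both displays are its (finite) value, and when it is not BOTH BOCHNER SIDES ARE `0`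
(Mathlib's convention for a divergent Bochner integral; `B2Eq246MaskedStep` HONEST SCOPE (c), `integral_prod_symm_of_nonneg`);
m² > 0, μ₀² > 0, a > 0, L > 1, `k ≤ K`; (e) nothing
quantitative ((2.47)/(2.48) are r14's `B2Sect2BDensities`).  Value = the two displays of the inductive definition typed with
bodies on the carrier of record and the sentence between them kernel-checked; NOT summit progress.  Unit `lit-balaban-r02` gen 52
(literature-prover-lit-balaban-r02-g52-0); HOME/FILED.md records the proposal; doc-only revision folding referee ref-4's D-g76-1
(HONEST SCOPE (d) and two docstrings worded by the Bochner convention) — declarations and proofs byte-identical to commit 30d1069b8aa4.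
-/

open scoped BigOperators InnerProductSpace Matrix
open _root_.MeasureTheory Matrix

namespace Literature.MathematicalPhysics.QuantumFieldTheory.Balaban1983to89.B2Eq245Assembled

open HiggsLattice HiggsAveraging HiggsCovariance B1Eq27StepAdjoint B1Eq221Coordinates B1Eq230FluctCov B1Eq230FluctCovPos
  HiggsCondCov232 HiggsCondGauss228 B2Eq255Concrete B2Eq227CondDelta B2Eq246ScalarStep B2Eq246MaskedStep
open B2Eq228Conditioning (In Out resIn resOut glue)
open B3MultiscaleFields (zeroCharge)

variable {P : HiggsLattice.Params} {N : ℕ}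

/-! ## §1 The data print attaches to (2.45)/(2.46) and the two displays -/

section Display

variable (P N) in
/-- **The data of (2.45)/(2.46) p. 567 for ONE admissible sequence `(Λ₀^{(0)}, …, Λ₀^{(k−1)})` at the `k`-th step** (level
`j = k − 1` of the lattice family; *"We will use the same notations for the sets in different scales"*, p. 566): the regions
`Λ₅^{(k−1)}` (as its set `Λ′₅` of block points, `Λ₅ = B(Λ′₅)`, a union of blocks as I (2.32) requires), `Λ₃^{(k−1)}`, `Λ₄^{(k−1)}`,
`Λ₆^{(k−2)′}` (sets of sites of `T^{(k−1)}`), `B^{k−1}(Λ₂^{(k−1)})` and `B^{k−1}(Λ₂^{(k−2)′} ∩ Λ₅^{(k−1)c})` (sets of sites of `T_η`, the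
Neumann regions of the two scalar operators); the external vector fields `A^{(k),ε}` (the form's and the covariance's field), `Ã`
(the kernel's field, *"Ã = (1 − θ_k)θ_{k−1}A^{(k−1),ε} + θ_kA^{(k),ε}"*) and `Ã′` (the field of `ρ′^{(k−1)}` and of the middle operator;
p. 569 *"B^{k−2}(Λ₂^{(k−2)})Ã^ε = Ã′"*); the characteristic functions `χ_k` (of the new fields), `ζ_{Λ₀^{(k−1)}}`,
`χ_{Λ₋₁^{(k−1)}∩Λ₅^{(k−1)c}}`, `χ_{k−1,Λ₅^{(k−1)c}}` (*"defined analogously to the corresponding functions in Sect. A"*; functions of the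
new fields `A, φ` and of the fluctuation fields `A′, φ′`) and the density `ρ′^{(k−1),L^{k−1}ε}(Λ₀^{(0)}, …, Λ₀^{(k−2)}, A′, Ã′, φ′)` — all as
DATA (print constructs them in (2.7)–(2.8)′, (2.44), (2.4)–(2.6)′, (2.15)′, (2.49)–(2.50); cf. `B2Eq253StepIntegral.SeqData`).
Vector fields in components on sites (p. 555: *"Vector field configurations are the functions A : T_ε → R^d"*).
[cite: Balaban1982Higgs2, (2.45)–(2.46) p.567] -/
structure Data245 (j : ℕ) where
  /-- `Λ′₅`: the block points of `Λ₅^{(k−1)} = B(Λ′₅)` (the conditioning region). [cite: Balaban1982Higgs2, (2.46) p.567] -/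
  L5 : Finset (HiggsLattice.Site P (j + 1))
  /-- `Λ₃^{(k−1)}` (the mask of the scalar basic form). [cite: Balaban1982Higgs2, (2.45) p.567] -/
  R3 : Finset (HiggsLattice.Site P j)
  /-- `Λ₄^{(k−1)}`. [cite: Balaban1982Higgs2, (2.45) p.567] -/
  R4 : Finset (HiggsLattice.Site P j)
  /-- `Λ₆^{(k−2)′}` read on `T^{(k−1)}` (the mask of the vector basic form). [cite: Balaban1982Higgs2, (2.45) p.567] -/
  R6p : Finset (HiggsLattice.Site P j)
  /-- `B^{k−1}(Λ₂^{(k−1)}) ⊂ T_η`. [cite: Balaban1982Higgs2, (2.45) p.567] -/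
  B2 : Finset (HiggsLattice.Site P 0)
  /-- `B^{k−1}(Λ₂^{(k−2)′} ∩ Λ₅^{(k−1)c}) ⊂ T_η`. [cite: Balaban1982Higgs2, (2.45) p.567] -/
  B2p : Finset (HiggsLattice.Site P 0)
  /-- `A^{(k),ε}` ((2.44)). [cite: Balaban1982Higgs2, (2.44) p.566] -/
  Ak : HiggsLattice.VecField P 0
  /-- `Ã = (1 − θ_k)θ_{k−1}A^{(k−1),ε} + θ_kA^{(k),ε}` (the kernel's field). [cite: Balaban1982Higgs2, (2.45) p.567] -/
  Atil : HiggsLattice.VecField P 0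
  /-- `Ã′` (p. 569). [cite: Balaban1982Higgs2, (2.51) p.569] -/
  Atil' : HiggsLattice.VecField P 0
  /-- `χ_k`, a function of the new fields `(A, φ)`. [cite: Balaban1982Higgs2, (2.45) p.567] -/
  chik : ScalarField P (j + 1) P.d → ScalarField P (j + 1) N → ℝ
  /-- `ζ_{Λ₀^{(k−1)}}` ((2.15)′), a function of `(A, φ, A′, φ′)`. [cite: Balaban1982Higgs2, (2.45) p.567] -/
  zeta : ScalarField P (j + 1) P.d → ScalarField P (j + 1) N → ScalarField P j P.d → ScalarField P j N → ℝ
  /-- `χ_{Λ₋₁^{(k−1)}∩Λ₅^{(k−1)c}}` (*"give the restrictions on the fields B, ψ, A, φ on the set Λ₋₁∩Λ₅ᶜ"*, p. 564). [cite: Balaban1982Higgs2, (2.45) p.567] -/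
  chi1 : ScalarField P (j + 1) P.d → ScalarField P (j + 1) N → ScalarField P j P.d → ScalarField P j N → ℝ
  /-- `χ_{k−1,Λ₅^{(k−1)c}}`. [cite: Balaban1982Higgs2, (2.45) p.567] -/
  chi2 : ScalarField P (j + 1) P.d → ScalarField P (j + 1) N → ScalarField P j P.d → ScalarField P j N → ℝ
  /-- `ρ′^{(k−1),L^{k−1}ε}(Λ₀^{(0)}, …, Λ₀^{(k−2)}, A′, Ã′, φ′)` as a function of `(A′, Ã′, φ′)`. [cite: Balaban1982Higgs2, (2.45) p.567] -/
  rhoP : ScalarField P j P.d → HiggsLattice.VecField P 0 → ScalarField P j N → ℝ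

variable {j : ℕ} (C : ChargeData N) (μ msq a : ℝ) (D : Data245 P N j)

/-- **The product `ζ_{Λ₀^{(k−1)}} χ_{Λ₋₁^{(k−1)}∩Λ₅^{(k−1)c}} χ_{k−1,Λ₅^{(k−1)c}} · ρ′^{(k−1),L^{k−1}ε}(…, A′, Ã′, φ′)`** of (2.45)/(2.46).
[cite: Balaban1982Higgs2, (2.45) p.567] -/
noncomputable def weight245 (An : ScalarField P (j + 1) P.d) (φ : ScalarField P (j + 1) N) (A' : ScalarField P j P.d)
    (φ' : ScalarField P j N) : ℝ :=
  D.zeta An φ A' φ' * D.chi1 An φ A' φ' * D.chi2 An φ A' φ' * D.rhoP A' D.Atil' φ'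

/-- **Line 1 of the exponential of (2.45)**: `−½⟨Λ₆^{(k−2)′}A′, Δ^{(k−1),L^{k−1}ε}Λ₆^{(k−2)′}A′⟩` — the vector basic form (I (2.21) at
`N = d`, external field `0`, whole torus, mass `μ₀²`; p. 568 *"Neumann boundary conditions are not introduced"*) on the MASKED
field. [cite: Balaban1982Higgs2, (2.45) p.567] -/
noncomputable def vecForm245 (A' : ScalarField P j P.d) : ℝ :=
  -(1 / 2 : ℝ) * siteInner (cutTo D.R6p A')
    (deltaKA (zeroCharge P.d) Finset.univ (0 : HiggsLattice.VecField P 0) μ a j (cutTo D.R6p A'))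

/-- **Lines 2–3 of the exponential of (2.45) = lines 5–6 of (2.46)** (unchanged by the conditioning — they live outside `Λ₄ ⊃ Λ₅`):
`−½⟨(Λ₆^{(k−2)′}∩Λ₃^{(k−1)c})φ′, Δ^{(k−1)}(B^{k−1}(Λ₂^{(k−2)′}∩Λ₅^{(k−1)c}), Ã′)(Λ₆^{(k−2)′}∩Λ₃^{(k−1)c})φ′⟩
− ⟨(Λ₆^{(k−2)′}∩Λ₃^{(k−1)c})φ′, Δ^{(k−1)}(B^{k−1}(Λ₂^{(k−2)′}∩Λ₅^{(k−1)c}), Ã′)(Λ₃^{(k−1)}∩Λ₄^{(k−1)c})φ′⟩`. [cite: Balaban1982Higgs2, (2.45)–(2.46) p.567] -/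
noncomputable def midForm245 (φ' : ScalarField P j N) : ℝ :=
  -(1 / 2 : ℝ) * siteInner (cutTo (D.R6p ∩ D.R3ᶜ) φ') (deltaKA C D.B2p D.Atil' msq a j (cutTo (D.R6p ∩ D.R3ᶜ) φ'))
    - siteInner (cutTo (D.R6p ∩ D.R3ᶜ) φ') (deltaKA C D.B2p D.Atil' msq a j (cutTo (D.R3 ∩ D.R4ᶜ) φ'))

/-- **Line 4 of the exponential of (2.45)**: `−½⟨Λ₃^{(k−1)}φ′, Δ^{(k−1),L^{k−1}ε}(B^{k−1}(Λ₂^{(k−1)}), A^{(k),ε})Λ₃^{(k−1)}φ′⟩` — the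
scalar basic form on the MASKED field. [cite: Balaban1982Higgs2, (2.45) p.567] -/
noncomputable def scalForm245 (φ' : ScalarField P j N) : ℝ :=
  -(1 / 2 : ℝ) * siteInner (cutTo D.R3 φ') (deltaKA C D.B2 D.Ak msq a j (cutTo D.R3 φ'))

/-- **(2.45)** p. 567 [PDF 13] AS DISPLAYED (verbatim in the module header): the density
`ρ″^{(k),L^kε}(Λ₀^{(0)}, …, Λ₀^{(k−1)}, A, θ_kA^{(k),ε}, φ)` as the function of the new fields `(A, φ)`
`χ_k · T^{L^{k−1}ε}_{a,L}[ T^{L^{k−1}ε}_{a,L,Ã}[ ζ_{Λ₀^{(k−1)}} χ_{Λ₋₁^{(k−1)}∩Λ₅^{(k−1)c}} χ_{k−1,Λ₅^{(k−1)c}} · ρ′^{(k−1),L^{k−1}ε}(…, A′, Ã′, φ′)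
 · exp[lines 1–4] ] ]`, the two renormalization transformations (I (2.4)–(2.6)) written as their kernel integrals `∫dA′ t_{a,L}(A, A′)[·]`,
`∫dφ′ t_{a,L,Ã}(φ, φ′)[·]` (`HiggsAveraging.rtKernelStep`, vector species at `N = d`, `zeroCharge`, field `0` as in
`B2Eq246PairStep`; Lebesgue measures on the site functions, I p. 605).  Print writes the kernel's field as `Ã′` in (2.45) and as
`Ã` in (2.46); one datum `Atil` serves both (HONEST SCOPE (b)). Convergence is not part of the display. [cite: Balaban1982Higgs2, (2.45) p.567] -/
noncomputable def display245 (An : ScalarField P (j + 1) P.d) (φ : ScalarField P (j + 1) N) : ℝ :=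
  D.chik An φ *
    ∫ A' : ScalarField P j P.d, rtKernelStep (zeroCharge P.d) a (0 : HiggsLattice.VecField P 0) An A' *
      ∫ φ' : ScalarField P j N, rtKernelStep C a D.Atil φ φ' *
        (weight245 D An φ A' φ'
          * Real.exp (vecForm245 μ a D A' + midForm245 C msq a D φ' + scalForm245 C msq a D φ'))

/-- **Lines 1–4 of the exponential of (2.46)** (vector species; `χ = (Λ₆^{(k−2)′}∩Λ₅^{(k−1)c})A′`, `Δ = Δ^{(k−1),L^{k−1}ε}`,
`C = C^{(k−1),L^{k−1}ε}_{Λ₅^{(k−1)}}`, `a(L^kε)^{−2}` ↦ `stepCoef`, `Δ^{(k),L^kε}_{Λ₅^{(k−1)}}` ↦ `condDelta227`, all at `N = d`, `zeroCharge`, field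
`0`, whole torus, mass `μ₀²`): `−½⟨χ, Δχ⟩ + ½⟨χ, ΔCΔχ⟩ − a(L^kε)^{−2}⟨χ, ΔCQ^*A⟩ − ½⟨A, Δ^{(k)}_{Λ₅}A⟩`. [cite: Balaban1982Higgs2, (2.46) p.567] -/
noncomputable def vecTerms246 (An : ScalarField P (j + 1) P.d) (A'e : ScalarField P j P.d) : ℝ :=
  -(1 / 2 : ℝ) * siteInner (cutTo (D.R6p ∩ (blockSet D.L5)ᶜ) A'e)
      (deltaKA (zeroCharge P.d) Finset.univ (0 : HiggsLattice.VecField P 0) μ a j (cutTo (D.R6p ∩ (blockSet D.L5)ᶜ) A'e))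
    + (1 / 2 : ℝ) * siteInner (cutTo (D.R6p ∩ (blockSet D.L5)ᶜ) A'e)
      (deltaKA (zeroCharge P.d) Finset.univ (0 : HiggsLattice.VecField P 0) μ a j
        (condCov232 (zeroCharge P.d) Finset.univ (0 : HiggsLattice.VecField P 0) μ a j (blockSet D.L5)
          (deltaKA (zeroCharge P.d) Finset.univ (0 : HiggsLattice.VecField P 0) μ a j (cutTo (D.R6p ∩ (blockSet D.L5)ᶜ) A'e))))
    - stepCoef P a j * siteInner (cutTo (D.R6p ∩ (blockSet D.L5)ᶜ) A'e)
      (deltaKA (zeroCharge P.d) Finset.univ (0 : HiggsLattice.VecField P 0) μ a j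
        (condCov232 (zeroCharge P.d) Finset.univ (0 : HiggsLattice.VecField P 0) μ a j (blockSet D.L5)
          (avgQAdjLin (zeroCharge P.d) (0 : HiggsLattice.VecField P 0) j An)))
    - (1 / 2 : ℝ) * siteInner An (condDelta227 (zeroCharge P.d) Finset.univ (0 : HiggsLattice.VecField P 0) μ a j D.L5 An)

/-- **Lines 7–10 of the exponential of (2.46)** (scalar species; `χ = (Λ₃^{(k−1)}∩Λ₅^{(k−1)c})φ′`, `Δ = Δ^{(k−1),L^{k−1}ε}(B^{k−1}(Λ₂^{(k−1)}),
A^{(k),ε})`, `C = C^{(k−1),L^{k−1}ε}_{Λ₅^{(k−1)}}(B^{k−1}(Λ₂^{(k−1)}), A^{(k),ε})`): `−½⟨χ, Δχ⟩ + ½⟨χ, ΔCΔχ⟩ − a(L^kε)^{−2}⟨χ, ΔCQ^*(A^{(k),ε})φ⟩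
− ½⟨φ, Δ^{(k),L^kε}_{Λ₅^{(k−1)}}(B^{k−1}(Λ₂^{(k−1)}), A^{(k),ε})φ⟩`. [cite: Balaban1982Higgs2, (2.46) p.567] -/
noncomputable def scalTerms246 (φ : ScalarField P (j + 1) N) (φ'e : ScalarField P j N) : ℝ :=
  -(1 / 2 : ℝ) * siteInner (cutTo (D.R3 ∩ (blockSet D.L5)ᶜ) φ'e)
      (deltaKA C D.B2 D.Ak msq a j (cutTo (D.R3 ∩ (blockSet D.L5)ᶜ) φ'e))
    + (1 / 2 : ℝ) * siteInner (cutTo (D.R3 ∩ (blockSet D.L5)ᶜ) φ'e)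
      (deltaKA C D.B2 D.Ak msq a j
        (condCov232 C D.B2 D.Ak msq a j (blockSet D.L5) (deltaKA C D.B2 D.Ak msq a j (cutTo (D.R3 ∩ (blockSet D.L5)ᶜ) φ'e))))
    - stepCoef P a j * siteInner (cutTo (D.R3 ∩ (blockSet D.L5)ᶜ) φ'e)
      (deltaKA C D.B2 D.Ak msq a j (condCov232 C D.B2 D.Ak msq a j (blockSet D.L5) (avgQAdjLin C D.Ak j φ)))
    - (1 / 2 : ℝ) * siteInner φ (condDelta227 C D.B2 D.Ak msq a j D.L5 φ)

/-- **(2.46)** p. 567 [PDF 13] AS DISPLAYED (verbatim in the module header):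
`χ_k ∫dA′↾_{Λ₅^{(k−1)c}} ∫dφ′↾_{Λ₅^{(k−1)c}} t^{L^{k−1}ε}_{a,L}(Λ₅^{(k−1)c}; A, A′) t^{L^{k−1}ε}_{a,L,Ã}(Λ₅^{(k−1)c}; φ, φ′) · ζχχ · ρ′^{(k−1),L^{k−1}ε}(…, A′, Ã′, φ′)
 · exp[lines 1–10] · Z^{(k−1),L^{k−1}ε}_{Λ₅^{(k−1)}} Z^{(k−1),L^{k−1}ε}_{Λ₅^{(k−1)}}(B^{k−1}(Λ₂^{(k−1)}), A^{(k),ε})` — `dA′↾_{Λ₅ᶜ}`, `dφ′↾_{Λ₅ᶜ}` the Lebesgue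
measures on the exterior coordinates (the typer's `Out (inSet · Λ₅)`, exterior fields `fieldOfOut`), the restricted kernels the
typer's `rtKernelOut`, the `Z`-factors the typer's `zCond252` ((2.52)). [cite: Balaban1982Higgs2, (2.46) p.567] -/
noncomputable def display246 (An : ScalarField P (j + 1) P.d) (φ : ScalarField P (j + 1) N) : ℝ :=
  D.chik An φ *
    (∫ y : Out (inSet (P := P) P.d (blockSet D.L5)) → ℝ, ∫ y' : Out (inSet (P := P) N (blockSet D.L5)) → ℝ,
      rtKernelOut (zeroCharge P.d) (0 : HiggsLattice.VecField P 0) a j D.L5 An (fieldOfOut (blockSet D.L5) y)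
        * rtKernelOut C D.Atil a j D.L5 φ (fieldOfOut (blockSet D.L5) y')
        * (weight245 D An φ (fieldOfOut (blockSet D.L5) y) (fieldOfOut (blockSet D.L5) y')
          * Real.exp (vecTerms246 μ a D An (fieldOfOut (blockSet D.L5) y)
              + midForm245 C msq a D (fieldOfOut (blockSet D.L5) y')
              + scalTerms246 C msq a D φ (fieldOfOut (blockSet D.L5) y'))))
    * (zCond252 (zeroCharge P.d) Finset.univ (0 : HiggsLattice.VecField P 0) μ a j D.L5 * zCond252 C D.B2 D.Ak msq a j D.L5)

end Display


/-! ## §2 The hypotheses print supplies for the data; cuts; continuity; the dictionary with the typer's `condTerms246` -/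

section Hyp

variable {j : ℕ}

/-- **What print's construction supplies about the data of (2.45)** (the hypotheses of `display245_eq_display246`):
the nesting `Λ₅^{(k−1)} ⊂ Λ₄^{(k−1)} ⊂ Λ₃^{(k−1)}` ((2.8)′) and `Λ₅^{(k−1)} ⊂ Λ₆^{(k−2)′}` (admissibility, p. 566: *"Λ₀^{(j+1)} ⊂ Λ₇^{(j)′}"*);
`Ã = A^{(k),ε}` on the bonds inside the blocks `B^{k−1}(y)`, `y ∈ Λ′₅` (*"θ_k … is equal to 1 on B^{k−1}(Λ₂^{(k−1)})"* ⊇ `B^{k−1}(Λ₅^{(k−1)})`);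
the three characteristic functions and `ρ′^{(k−1)}` depend on the fluctuation fields `A′, φ′` only outside `Λ₅^{(k−1)}` (the
conditioning *"on Λ₅^{(k−1)c}"*; for `ρ′`: (2.50) at step `k − 1`, `Λ₅^{(k−1)} ⊂ Λ₇^{(k−2)′}`), are nonnegative (characteristic
functions; `ρ′` a density) and jointly measurable in `(A′, φ′)`. [cite: Balaban1982Higgs2, (2.45)–(2.46) p.567] -/
structure Data245.Hyp (D : Data245 P N j) : Prop where
  /-- `Λ₅^{(k−1)} ⊂ Λ₃^{(k−1)}`. [cite: Balaban1982Higgs2, (2.8) p.558] -/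
  L5_R3 : blockSet D.L5 ⊆ D.R3
  /-- `Λ₅^{(k−1)} ⊂ Λ₄^{(k−1)}`. [cite: Balaban1982Higgs2, (2.8) p.558] -/
  L5_R4 : blockSet D.L5 ⊆ D.R4
  /-- `Λ₅^{(k−1)} ⊂ Λ₆^{(k−2)′}`. [cite: Balaban1982Higgs2, (2.43) p.566] -/
  L5_R6 : blockSet D.L5 ⊆ D.R6p
  /-- `Ã = A^{(k),ε}` on the bonds inside each `B^{k−1}(y)`, `y ∈ Λ′₅`. [cite: Balaban1982Higgs2, (2.45) p.567] -/
  atil : ∀ b : HiggsLattice.PBond P 0, blockIter (j + 1) b.src ∈ D.L5 → blockIter (j + 1) b.tgt ∈ D.L5 →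
    blockIter (j + 1) b.src = blockIter (j + 1) b.tgt → D.Atil b = D.Ak b
  /-- `ζ_{Λ₀^{(k−1)}}` sees `A′, φ′` outside `Λ₅` only. [cite: Balaban1982Higgs2, (2.46) p.567] -/
  zeta_loc : ∀ An φ A' φ', D.zeta An φ A' φ' = D.zeta An φ (cutTo (blockSet D.L5)ᶜ A') (cutTo (blockSet D.L5)ᶜ φ')
  /-- `χ_{Λ₋₁∩Λ₅ᶜ}` sees `A′, φ′` outside `Λ₅` only. [cite: Balaban1982Higgs2, (2.46) p.567] -/
  chi1_loc : ∀ An φ A' φ', D.chi1 An φ A' φ' = D.chi1 An φ (cutTo (blockSet D.L5)ᶜ A') (cutTo (blockSet D.L5)ᶜ φ')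
  /-- `χ_{k−1,Λ₅ᶜ}` sees `A′, φ′` outside `Λ₅` only. [cite: Balaban1982Higgs2, (2.46) p.567] -/
  chi2_loc : ∀ An φ A' φ', D.chi2 An φ A' φ' = D.chi2 An φ (cutTo (blockSet D.L5)ᶜ A') (cutTo (blockSet D.L5)ᶜ φ')
  /-- `ρ′^{(k−1)}` sees `A′, φ′` outside `Λ₅` only ((2.50) at step `k−1`). [cite: Balaban1982Higgs2, (2.50) p.568] -/
  rhoP_loc : ∀ A' φ', D.rhoP A' D.Atil' φ' = D.rhoP (cutTo (blockSet D.L5)ᶜ A') D.Atil' (cutTo (blockSet D.L5)ᶜ φ')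
  /-- `ζ ≥ 0`. [cite: Balaban1982Higgs2, (2.15) p.559] -/
  zeta_nonneg : ∀ An φ A' φ', 0 ≤ D.zeta An φ A' φ'
  /-- `χ ≥ 0`. [cite: Balaban1982Higgs2, (2.6) p.558] -/
  chi1_nonneg : ∀ An φ A' φ', 0 ≤ D.chi1 An φ A' φ'
  /-- `χ ≥ 0`. [cite: Balaban1982Higgs2, (2.6) p.558] -/
  chi2_nonneg : ∀ An φ A' φ', 0 ≤ D.chi2 An φ A' φ'
  /-- `ρ′ ≥ 0`. [cite: Balaban1982Higgs2, (2.49) p.568] -/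
  rhoP_nonneg : ∀ A' φ', 0 ≤ D.rhoP A' D.Atil' φ'
  /-- `ζ` jointly measurable in `(A′, φ′)`. [cite: Balaban1982Higgs2, (2.45) p.567] -/
  zeta_meas : ∀ An φ, Measurable fun q : ScalarField P j P.d × ScalarField P j N => D.zeta An φ q.1 q.2
  /-- `χ` jointly measurable in `(A′, φ′)`. [cite: Balaban1982Higgs2, (2.45) p.567] -/
  chi1_meas : ∀ An φ, Measurable fun q : ScalarField P j P.d × ScalarField P j N => D.chi1 An φ q.1 q.2
  /-- `χ` jointly measurable in `(A′, φ′)`. [cite: Balaban1982Higgs2, (2.45) p.567] -/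
  chi2_meas : ∀ An φ, Measurable fun q : ScalarField P j P.d × ScalarField P j N => D.chi2 An φ q.1 q.2
  /-- `ρ′` jointly measurable in `(A′, φ′)`. [cite: Balaban1982Higgs2, (2.45) p.567] -/
  rhoP_meas : Measurable fun q : ScalarField P j P.d × ScalarField P j N => D.rhoP q.1 D.Atil' q.2

variable {D : Data245 P N j}

/-- The weight sees `A′, φ′` outside `Λ₅` only. [cite: Balaban1982Higgs2, (2.46) p.567] -/
theorem weight245_loc (h : D.Hyp) (An : ScalarField P (j + 1) P.d) (φ : ScalarField P (j + 1) N) (A' : ScalarField P j P.d)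
    (φ' : ScalarField P j N) :
    weight245 D An φ A' φ' = weight245 D An φ (cutTo (blockSet D.L5)ᶜ A') (cutTo (blockSet D.L5)ᶜ φ') := by
  unfold weight245
  rw [h.zeta_loc An φ A' φ', h.chi1_loc An φ A' φ', h.chi2_loc An φ A' φ', h.rhoP_loc A' φ']

/-- The weight is nonnegative. [cite: Balaban1982Higgs2, (2.46) p.567] -/
theorem weight245_nonneg (h : D.Hyp) (An : ScalarField P (j + 1) P.d) (φ : ScalarField P (j + 1) N) (A' : ScalarField P j P.d)
    (φ' : ScalarField P j N) : 0 ≤ weight245 D An φ A' φ' :=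
  mul_nonneg (mul_nonneg (mul_nonneg (h.zeta_nonneg _ _ _ _) (h.chi1_nonneg _ _ _ _)) (h.chi2_nonneg _ _ _ _)) (h.rhoP_nonneg _ _)

/-- The weight is jointly measurable in `(A′, φ′)`. [cite: Balaban1982Higgs2, (2.46) p.567] -/
theorem measurable_weight245 (h : D.Hyp) (An : ScalarField P (j + 1) P.d) (φ : ScalarField P (j + 1) N) :
    Measurable fun q : ScalarField P j P.d × ScalarField P j N => weight245 D An φ q.1 q.2 :=
  (((h.zeta_meas An φ).mul (h.chi1_meas An φ)).mul (h.chi2_meas An φ)).mul h.rhoP_meas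

/-- Iterated cuts: `S(Tφ) = (T ∩ S)φ`. [cite: Balaban1982Higgs2, (2.50) p.568] -/
theorem cutTo_cutTo_eq_inter (S T : Finset (HiggsLattice.Site P j)) (φ : ScalarField P j N) :
    cutTo S (cutTo T φ) = cutTo (T ∩ S) φ := by
  funext x
  by_cases hS : x ∈ S <;> by_cases hT : x ∈ T <;> simp [cutTo, hS, hT]

/-- `S(Tφ) = Sφ` for `S ⊆ T`. [cite: Balaban1982Higgs2, (2.50) p.568] -/
theorem cutTo_cutTo_of_subset {S T : Finset (HiggsLattice.Site P j)} (hST : S ⊆ T) (φ : ScalarField P j N) :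
    cutTo S (cutTo T φ) = cutTo S φ := by
  rw [cutTo_cutTo_eq_inter, Finset.inter_eq_right.mpr hST]

/-- The weight sees `φ′` outside `Λ₅` only (one-sided form). [cite: Balaban1982Higgs2, (2.46) p.567] -/
theorem weight245_loc_right (h : D.Hyp) (An : ScalarField P (j + 1) P.d) (φ : ScalarField P (j + 1) N) (A' : ScalarField P j P.d)
    (φ' : ScalarField P j N) :
    weight245 D An φ A' φ' = weight245 D An φ A' (cutTo (blockSet D.L5)ᶜ φ') := by
  rw [weight245_loc h An φ A' φ', weight245_loc h An φ A' (cutTo _ φ'), cutTo_cutTo_of_subset le_rfl]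

/-- The weight sees `A′` outside `Λ₅` only (one-sided form). [cite: Balaban1982Higgs2, (2.46) p.567] -/
theorem weight245_loc_left (h : D.Hyp) (An : ScalarField P (j + 1) P.d) (φ : ScalarField P (j + 1) N) (A' : ScalarField P j P.d)
    (φ' : ScalarField P j N) :
    weight245 D An φ A' φ' = weight245 D An φ (cutTo (blockSet D.L5)ᶜ A') φ' := by
  rw [weight245_loc h An φ A' φ', weight245_loc h An φ (cutTo _ A') φ', cutTo_cutTo_of_subset le_rfl]

variable (C : ChargeData N) (μ msq a : ℝ)

/-- **The middle terms live outside `Λ₄^{(k−1)} ⊃ Λ₅^{(k−1)}`**: they see `φ′` outside `Λ₅` only. [cite: Balaban1982Higgs2, (2.46) p.567] -/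
theorem midForm245_cutTo (h : D.Hyp) (φ' : ScalarField P j N) :
    midForm245 C msq a D (cutTo (blockSet D.L5)ᶜ φ') = midForm245 C msq a D φ' := by
  have h1 : D.R6p ∩ D.R3ᶜ ⊆ (blockSet D.L5)ᶜ := fun x hx =>
    Finset.mem_compl.mpr fun hx5 => (Finset.mem_compl.mp (Finset.mem_inter.mp hx).2) (h.L5_R3 hx5)
  have h2 : D.R3 ∩ D.R4ᶜ ⊆ (blockSet D.L5)ᶜ := fun x hx =>
    Finset.mem_compl.mpr fun hx5 => (Finset.mem_compl.mp (Finset.mem_inter.mp hx).2) (h.L5_R4 hx5)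
  unfold midForm245
  rw [cutTo_cutTo_of_subset h1, cutTo_cutTo_of_subset h2]

/-- DICTIONARY: lines 7–10 of (2.46) ARE the typer's `condTerms246` (at `(C, B^{k−1}(Λ₂^{(k−1)}), A^{(k),ε})`, `Λ′₅`) at the MASKED
exterior field `Λ₃^{(k−1)}φ′↾_{Λ₅ᶜ}`. [cite: Balaban1982Higgs2, (2.46) p.567] -/
theorem scalTerms246_eq (φ : ScalarField P (j + 1) N) (φ'e : ScalarField P j N) :
    scalTerms246 C msq a D φ φ'e = condTerms246 C D.B2 D.Ak msq a j D.L5 φ (cutTo D.R3 φ'e) := by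
  rw [scalTerms246, condTerms246, cutTo_cutTo_eq_inter]

/-- DICTIONARY: lines 1–4 of (2.46) ARE the typer's `condTerms246` at the vector letters (`N = d`, `zeroCharge`, field `0`, whole
torus, mass `μ₀²`) at the MASKED exterior field `Λ₆^{(k−2)′}A′↾_{Λ₅ᶜ}`. [cite: Balaban1982Higgs2, (2.46) p.567] -/
theorem vecTerms246_eq (An : ScalarField P (j + 1) P.d) (A'e : ScalarField P j P.d) :
    vecTerms246 μ a D An A'e
      = condTerms246 (zeroCharge P.d) Finset.univ (0 : HiggsLattice.VecField P 0) μ a j D.L5 An (cutTo D.R6p A'e) := by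
  rw [vecTerms246, condTerms246, cutTo_cutTo_eq_inter]

/-- `φ′ ↦ t(Λ₅ᶜ; ψ, φ′)` is continuous. [folklore] [cite: Balaban1982Higgs1, (2.5) p.608] -/
theorem continuous_rtKernelOut (A : HiggsLattice.VecField P 0) (Λ' : Finset (HiggsLattice.Site P (j + 1)))
    (ψ : ScalarField P (j + 1) N) : Continuous (rtKernelOut C A a j Λ' ψ) := by
  unfold rtKernelOut
  exact continuous_finsetProd _ fun y _ => (B1RT.continuous_rtKernel _).comp
    (continuous_const.sub ((continuous_apply y).comp (HiggsDoubleRT.continuous_avgQ_comp C continuous_const continuous_id)))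

/-- `φ′ ↦ condTerms246(ψ, φ′)` is continuous. [folklore] [cite: Balaban1982Higgs2, (2.46) p.567] -/
theorem continuous_condTerms246 (Ω : Finset (HiggsLattice.Site P 0)) (A : HiggsLattice.VecField P 0)
    (Λ' : Finset (HiggsLattice.Site P (j + 1))) (ψ : ScalarField P (j + 1) N) :
    Continuous (condTerms246 C Ω A msq a j Λ' ψ) := by
  have hc : Continuous (cutTo (N := N) (blockSet Λ')ᶜ) := continuous_cutTo _
  have hΔ := (deltaKA C Ω A msq a j).continuous_of_finiteDimensional
  have hC := (condCov232 C Ω A msq a j (blockSet Λ')).continuous_of_finiteDimensional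
  unfold condTerms246
  exact (((continuous_const.mul (HiggsFluctMeasure.continuous_siteInner hc (hΔ.comp hc))).add
    (continuous_const.mul (HiggsFluctMeasure.continuous_siteInner hc (hΔ.comp (hC.comp (hΔ.comp hc)))))).sub
    (continuous_const.mul (HiggsFluctMeasure.continuous_siteInner hc continuous_const))).sub continuous_const

/-- `φ′ ↦ midForm245(φ′)` is continuous. [folklore] [cite: Balaban1982Higgs2, (2.45) p.567] -/
theorem continuous_midForm245 : Continuous (midForm245 C msq a D) := by
  have hc1 : Continuous (cutTo (N := N) (D.R6p ∩ D.R3ᶜ)) := continuous_cutTo _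
  have hc2 : Continuous (cutTo (N := N) (D.R3 ∩ D.R4ᶜ)) := continuous_cutTo _
  have hΔ := (deltaKA C D.B2p D.Atil' msq a j).continuous_of_finiteDimensional
  unfold midForm245
  exact (continuous_const.mul (HiggsFluctMeasure.continuous_siteInner hc1 (hΔ.comp hc1))).sub
    (HiggsFluctMeasure.continuous_siteInner hc1 (hΔ.comp hc2))

end Hyp


/-! ## §3 The inner conditional integration: `dφ′` (scalar species, mask `Λ₃^{(k−1)}`, kernel field `Ã`) -/

section Inner

variable {j : ℕ} (C : ChargeData N) (μ msq a : ℝ) {D : Data245 P N j}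

/-- **The `φ′`-integration of (2.45) conditioned on `Λ₅^{(k−1)c}`**: at fixed new fields `(A, φ)` and fixed `A′`,
`∫dφ′ t_{a,L,Ã}(φ,φ′)·ζχχρ′·exp[lines 1–4] = e^{line 1} · ∫dφ′↾_{Λ₅ᶜ} t_Ã(Λ₅ᶜ;φ,φ′)·e^{lines 7–10}·ζχχρ′·e^{lines 5–6} · Z^{(k−1)}_{Λ₅}(B^{k−1}(Λ₂^{(k−1)}), A^{(k),ε})`
— `B2Eq246MaskedStep.rt_condStep_masked` at the scalar letters with the weight `ζχχρ′·e^{lines 5–6}` (a function of `Λ₅ᶜφ′`);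
no convergence hypothesis (both sides are the (finite) integral when the integrand is integrable, both Bochner sides `0` otherwise).
[cite: Balaban1982Higgs2, (2.46) p.567] -/
theorem inner_step {μ msq a : ℝ} (hmsq : 0 < msq) (ha : 0 < a) (hL : 1 < (P.L : ℝ)) (hj : j + 1 ≤ P.K) (h : D.Hyp)
    (An : ScalarField P (j + 1) P.d) (φ : ScalarField P (j + 1) N) (A' : ScalarField P j P.d) :
    ∫ φ' : ScalarField P j N, rtKernelStep C a D.Atil φ φ' *
        (weight245 D An φ A' φ' * Real.exp (vecForm245 μ a D A' + midForm245 C msq a D φ' + scalForm245 C msq a D φ'))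
      = Real.exp (vecForm245 μ a D A') *
        ((∫ y' : Out (inSet (P := P) N (blockSet D.L5)) → ℝ,
            rtKernelOut C D.Atil a j D.L5 φ (fieldOfOut (blockSet D.L5) y')
              * (Real.exp (condTerms246 C D.B2 D.Ak msq a j D.L5 φ (cutTo D.R3 (fieldOfOut (blockSet D.L5) y')))
                * (weight245 D An φ A' (fieldOfOut (blockSet D.L5) y')
                  * Real.exp (midForm245 C msq a D (fieldOfOut (blockSet D.L5) y')))))
          * zCond252 C D.B2 D.Ak msq a j D.L5) := by
  -- the weight of the scalar step: `ζχχρ′ · e^{lines 5–6}` as a function of the exterior field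
  set G : ScalarField P j N → ℝ := fun φe => weight245 D An φ A' φe * Real.exp (midForm245 C msq a D φe) with hG_def
  have hG : Measurable G :=
    ((measurable_weight245 h An φ).comp (measurable_const.prodMk measurable_id)).mul
      (Real.continuous_exp.comp (continuous_midForm245 C msq a (D := D))).measurable
  have hG0 : ∀ φe, 0 ≤ G φe := fun φe => mul_nonneg (weight245_nonneg h An φ A' φe) (Real.exp_pos _).le
  have hpt : ∀ φ' : ScalarField P j N,
      rtKernelStep C a D.Atil φ φ'
          * (weight245 D An φ A' φ' * Real.exp (vecForm245 μ a D A' + midForm245 C msq a D φ' + scalForm245 C msq a D φ'))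
        = Real.exp (vecForm245 μ a D A') *
          (rtKernelStep C a D.Atil φ φ'
            * (Real.exp (-(1 / 2 : ℝ) * siteInner (cutTo D.R3 φ') (deltaKA C D.B2 D.Ak msq a j (cutTo D.R3 φ')))
              * G (cutTo (blockSet D.L5)ᶜ φ'))) := by
    intro φ'
    rw [hG_def]
    beta_reduce
    rw [midForm245_cutTo C msq a h, ← weight245_loc_right h An φ A' φ', Real.exp_add, Real.exp_add, scalForm245]
    ring
  simp_rw [hpt]
  rw [integral_const_mul, rt_condStep_masked C D.B2 D.Ak hmsq ha hL hj D.L5 h.L5_R3 h.atil hG hG0 φ]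

end Inner


/-! ## §4 The outer conditional integration: `dA′` (vector species, mask `Λ₆^{(k−2)′}`), and (2.45) = (2.46) -/

section Outer

variable {j : ℕ} (C : ChargeData N) (μ msq a : ℝ) {D : Data245 P N j}

/-- The `φ′↾_{Λ₅ᶜ}`-integrand of (2.46) at fixed `(A, φ)` as a function of `(Λ₅ᶜA′, φ′↾_{Λ₅ᶜ})`: jointly measurable.
[folklore] [cite: Balaban1982Higgs2, (2.46) p.567] -/
theorem measurable_innerIntegrand (h : D.Hyp) (An : ScalarField P (j + 1) P.d) (φ : ScalarField P (j + 1) N) :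
    Measurable fun q : ScalarField P j P.d × (Out (inSet (P := P) N (blockSet D.L5)) → ℝ) =>
      rtKernelOut C D.Atil a j D.L5 φ (fieldOfOut (blockSet D.L5) q.2)
        * (Real.exp (condTerms246 C D.B2 D.Ak msq a j D.L5 φ (cutTo D.R3 (fieldOfOut (blockSet D.L5) q.2)))
          * (weight245 D An φ q.1 (fieldOfOut (blockSet D.L5) q.2)
            * Real.exp (midForm245 C msq a D (fieldOfOut (blockSet D.L5) q.2)))) := by
  have hfo : Measurable fun q : ScalarField P j P.d × (Out (inSet (P := P) N (blockSet D.L5)) → ℝ) =>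
      fieldOfOut (blockSet D.L5) q.2 := (measurable_fieldOfOut _).comp measurable_snd
  have m1 := (continuous_rtKernelOut C a D.Atil D.L5 φ).measurable.comp hfo
  have m2 := (Real.continuous_exp.comp ((continuous_condTerms246 C msq a D.B2 D.Ak D.L5 φ).comp
    (continuous_cutTo D.R3))).measurable.comp hfo
  have m3 := (measurable_weight245 h An φ).comp (measurable_fst.prodMk hfo)
  have m4 := (Real.continuous_exp.comp (continuous_midForm245 C msq a (D := D))).measurable.comp hfo
  exact m1.mul (m2.mul (m3.mul m4))

/-- **The `A′`-integration of (2.45) conditioned on `Λ₅^{(k−1)c}`, after the inner one** — `B2Eq246MaskedStep.rt_condStep_masked`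
at the vector letters (`N = d`, `zeroCharge`, field `0`, whole torus, mass `μ₀²`; mask `Λ₆^{(k−2)′}`; kernel field = form field = `0`)
with the weight `Λ₅ᶜA′ ↦ [∫dφ′↾_{Λ₅ᶜ} …]·Z` produced by `inner_step` (nonnegative; measurable by Fubini–Tonelli measurability):
`∫dA′ t_{a,L}(A,A′) ∫dφ′ t_{a,L,Ã}(φ,φ′)·ζχχρ′·e^{lines 1–4 of (2.45)} = [∫dA′↾_{Λ₅ᶜ}∫dφ′↾_{Λ₅ᶜ} t(Λ₅ᶜ;A,A′) t_Ã(Λ₅ᶜ;φ,φ′)·ζχχρ′·e^{lines 1–10 of (2.46)}]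
· Z^{(k−1)}_{Λ₅} Z^{(k−1)}_{Λ₅}(B^{k−1}(Λ₂^{(k−1)}), A^{(k),ε})`. [cite: Balaban1982Higgs2, (2.46) p.567] -/
theorem outer_step {μ msq a : ℝ} (hmsq : 0 < msq) (hμ : 0 < μ) (ha : 0 < a) (hL : 1 < (P.L : ℝ)) (hj : j + 1 ≤ P.K)
    (h : D.Hyp) (An : ScalarField P (j + 1) P.d) (φ : ScalarField P (j + 1) N) :
    ∫ A' : ScalarField P j P.d, rtKernelStep (zeroCharge P.d) a (0 : HiggsLattice.VecField P 0) An A' *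
        ∫ φ' : ScalarField P j N, rtKernelStep C a D.Atil φ φ' *
          (weight245 D An φ A' φ' * Real.exp (vecForm245 μ a D A' + midForm245 C msq a D φ' + scalForm245 C msq a D φ'))
      = (∫ y : Out (inSet (P := P) P.d (blockSet D.L5)) → ℝ, ∫ y' : Out (inSet (P := P) N (blockSet D.L5)) → ℝ,
          rtKernelOut (zeroCharge P.d) (0 : HiggsLattice.VecField P 0) a j D.L5 An (fieldOfOut (blockSet D.L5) y)
            * rtKernelOut C D.Atil a j D.L5 φ (fieldOfOut (blockSet D.L5) y')
            * (weight245 D An φ (fieldOfOut (blockSet D.L5) y) (fieldOfOut (blockSet D.L5) y')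
              * Real.exp (vecTerms246 μ a D An (fieldOfOut (blockSet D.L5) y)
                  + midForm245 C msq a D (fieldOfOut (blockSet D.L5) y')
                  + scalTerms246 C msq a D φ (fieldOfOut (blockSet D.L5) y'))))
        * (zCond252 (zeroCharge P.d) Finset.univ (0 : HiggsLattice.VecField P 0) μ a j D.L5
            * zCond252 C D.B2 D.Ak msq a j D.L5) := by
  -- the inner integral as a function of the exterior vector field
  set I : ScalarField P j P.d → ℝ := fun A'e =>
    ∫ y' : Out (inSet (P := P) N (blockSet D.L5)) → ℝ,
      rtKernelOut C D.Atil a j D.L5 φ (fieldOfOut (blockSet D.L5) y')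
        * (Real.exp (condTerms246 C D.B2 D.Ak msq a j D.L5 φ (cutTo D.R3 (fieldOfOut (blockSet D.L5) y')))
          * (weight245 D An φ A'e (fieldOfOut (blockSet D.L5) y')
            * Real.exp (midForm245 C msq a D (fieldOfOut (blockSet D.L5) y')))) with hI_def
  have hIloc : ∀ A' : ScalarField P j P.d, I A' = I (cutTo (blockSet D.L5)ᶜ A') := by
    intro A'
    simp only [hI_def]
    refine integral_congr_ae (Filter.Eventually.of_forall fun y' => ?_)
    beta_reduce
    rw [← weight245_loc_left h An φ A']
  have hImeas : Measurable I :=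
    ((measurable_innerIntegrand C msq a h An φ).stronglyMeasurable.integral_prod_right').measurable
  have hI0 : ∀ A'e, 0 ≤ I A'e := fun A'e =>
    integral_nonneg fun y' => mul_nonneg (rtKernelOut_pos C D.Atil ha D.L5 φ _).le
      (mul_nonneg (Real.exp_pos _).le (mul_nonneg (weight245_nonneg h An φ _ _) (Real.exp_pos _).le))
  have hZs : 0 < zCond252 C D.B2 D.Ak msq a j D.L5 := zCond252_pos C D.B2 D.Ak hmsq ha hL (by omega) D.L5
  -- the weight of the vector step
  set H : ScalarField P j P.d → ℝ := fun A'e => I A'e * zCond252 C D.B2 D.Ak msq a j D.L5 with hH_def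
  have hH : Measurable H := hImeas.mul measurable_const
  have hH0 : ∀ A'e, 0 ≤ H A'e := fun A'e => mul_nonneg (hI0 A'e) hZs.le
  have hpt : ∀ A' : ScalarField P j P.d,
      rtKernelStep (zeroCharge P.d) a (0 : HiggsLattice.VecField P 0) An A' *
          ∫ φ' : ScalarField P j N, rtKernelStep C a D.Atil φ φ' *
            (weight245 D An φ A' φ' * Real.exp (vecForm245 μ a D A' + midForm245 C msq a D φ' + scalForm245 C msq a D φ'))
        = rtKernelStep (zeroCharge P.d) a (0 : HiggsLattice.VecField P 0) An A' *
          (Real.exp (-(1 / 2 : ℝ) * siteInner (cutTo D.R6p A')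
              (deltaKA (zeroCharge P.d) Finset.univ (0 : HiggsLattice.VecField P 0) μ a j (cutTo D.R6p A')))
            * H (cutTo (blockSet D.L5)ᶜ A')) := by
    intro A'
    rw [inner_step C hmsq ha hL hj h An φ A', hH_def]
    beta_reduce
    rw [← hIloc A', hI_def, vecForm245]
  simp_rw [hpt]
  rw [rt_condStep_masked (zeroCharge P.d) Finset.univ (0 : HiggsLattice.VecField P 0) hμ ha hL hj D.L5 h.L5_R6
    (Ak := (0 : HiggsLattice.VecField P 0)) (fun _ _ _ _ => rfl) hH hH0 An]
  -- bookkeeping: unfold `H`, `I`, move the constants inside, identify the exponents with the printed lines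
  have hpt2 : ∀ y : Out (inSet (P := P) P.d (blockSet D.L5)) → ℝ,
      rtKernelOut (zeroCharge P.d) (0 : HiggsLattice.VecField P 0) a j D.L5 An (fieldOfOut (blockSet D.L5) y)
          * (Real.exp (condTerms246 (zeroCharge P.d) Finset.univ (0 : HiggsLattice.VecField P 0) μ a j D.L5 An
              (cutTo D.R6p (fieldOfOut (blockSet D.L5) y))) * H (fieldOfOut (blockSet D.L5) y))
        = ∫ y' : Out (inSet (P := P) N (blockSet D.L5)) → ℝ,
            rtKernelOut (zeroCharge P.d) (0 : HiggsLattice.VecField P 0) a j D.L5 An (fieldOfOut (blockSet D.L5) y)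
              * rtKernelOut C D.Atil a j D.L5 φ (fieldOfOut (blockSet D.L5) y')
              * (weight245 D An φ (fieldOfOut (blockSet D.L5) y) (fieldOfOut (blockSet D.L5) y')
                * Real.exp (vecTerms246 μ a D An (fieldOfOut (blockSet D.L5) y)
                    + midForm245 C msq a D (fieldOfOut (blockSet D.L5) y')
                    + scalTerms246 C msq a D φ (fieldOfOut (blockSet D.L5) y')))
              * zCond252 C D.B2 D.Ak msq a j D.L5 := by
    intro y
    simp only [hH_def, hI_def]
    rw [← integral_mul_const, ← integral_const_mul, ← integral_const_mul]
    refine integral_congr_ae (Filter.Eventually.of_forall fun y' => ?_)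
    beta_reduce
    rw [← vecTerms246_eq, ← scalTerms246_eq, Real.exp_add, Real.exp_add]
    ring
  simp_rw [hpt2]
  simp_rw [integral_mul_const]
  ring

/-- **(2.45) = (2.46)** p. 567 — *"Another representation is obtained by calculation of a conditional integral in (2.45) with
the conditioning on Λ₅^{(k−1)c}"* — PROVED for the two displays as typed here, for every data satisfying what print's
construction supplies (`Data245.Hyp`), m² > 0, μ₀² > 0, a > 0, L > 1, `k ≤ K` (`j + 1 ≤ K`): both conditional integrations
(`dφ′` with the mask `Λ₃^{(k−1)}` and the kernel field `Ã`, then `dA′` with the mask `Λ₆^{(k−2)′}`) by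
`B2Eq246MaskedStep.rt_condStep_masked`; no convergence hypothesis (both displays are the (finite) integral when the integrand
is integrable, and both Bochner sides are `0` when it is not). [cite: Balaban1982Higgs2, (2.45)–(2.46) p.567] -/
theorem display245_eq_display246 {μ msq a : ℝ} (hmsq : 0 < msq) (hμ : 0 < μ) (ha : 0 < a) (hL : 1 < (P.L : ℝ))
    (hj : j + 1 ≤ P.K) (h : D.Hyp) (An : ScalarField P (j + 1) P.d) (φ : ScalarField P (j + 1) N) :
    display245 C μ msq a D An φ = display246 C μ msq a D An φ := by
  rw [display245, outer_step C hmsq hμ ha hL hj h An φ, display246, mul_assoc]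

end Outer

end Literature.MathematicalPhysics.QuantumFieldTheory.Balaban1983to89.B2Eq245Assembled
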